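import Literature.Geometry.Lorentzian.CoordScalarCurvatureEvolution
import Literature.Geometry.Lorentzian.CoordDivergenceIdentity
import Literature.Geometry.Lorentzian.CoordEntropyEvolution
import Literature.Geometry.Lorentzian.CoordCylinderFunctional
import HarnessLib

/-!
# The first variation of the scalar curvature in a general direction (Besse, Thm. 1.174 (e))

Everything here is PROVED; no statement of `Prop` type is introduced.

For a smooth one-parameter family `G : ℝ → E → (E →L E →L ℝ)` of metric components on `V × S`
(`MetricCoord.IsMetricFamilyOn`, any signature) with variation `h = ∂G/∂t` (`tDeriv`),
`CoordScalarCurvatureEvolution.lean` proves the raw basis form of `∂_t S`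
(`IsMetricFamilyOn.hasDerivWithinAt_scalAt`: `∂_t S = Σ ∂_t g^{kl} Ric_{kl} + tr_G ∂_t Ric`) and closes
it only for the Ricci flow `h = −2 Ric` (and `CoordScalarCurvatureVariation.lean` for `h = Ric`),
where the double-divergence term drops out by the contracted Bianchi identity. This file proves
the formula for a GENERAL variation `h` (Besse 1987, Thm. 1.174 (e),
`s'_g h = Δ_g(tr_g h) + δ_g(δ_g h) − g(r_g, h)` in Besse's sign conventions `Δ_g = δ d`,
`δ_g = −div_g`; Topping 2006, Prop. 2.3.9, `∂_t R = −⟨Ric, h⟩ + δ²h − Δ(tr h)`), in the tree's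
conventions (`lapAt = tr_G Hess`, `divAt = tr ∇`):

  `∂_t S = −⟨h, Ric⟩_G + div W − ½ Δ_G (tr_G h)`,   `G(W, Z) = (div_G h)(Z) − ½ ∂_Z (tr_G h)`,

where `W = Σ_{kl} g^{kl} Π(b_k, b_l)` is the metric trace of the variation `Π = ∂_t Γ` of the
Christoffel map (`varChrTrace`; the vector field `(div_G h)^♯ − ½ ∇(tr_G h)`, so that
`div W − ½ Δ tr h = div div h − Δ tr h`).

* `apply_varChrTrace` — `G(W, Z) = Σ_{kl} g^{kl} (∇_{b_k} h)(b_l, Z) − ½ ∂_Z(tr_G h)`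
  (Besse 1987, 1.174 (a) traced; Topping 2006, (2.3.15));
* `sum_coord_varChrAt_eq_half` — `Σᵢ bⁱ(Π(bᵢ, Z)) = ½ ∂_Z(tr_G h)` (Topping 2006, (2.3.16));
* `sum_ginv_fderiv_varChrAt_eq_fderiv`, `termA_eq_divAt` — the first trace of `∂_t Ric` is `div W`;
* `termB_eq_half_lapAt` — the second trace of `∂_t Ric` is `½ Δ(tr_G h)`;
* `sum_dginv_ricAt_eq_neg_pairAt` — `Σ_{kl} ∂_t g^{kl} Ric_{kl} = −⟨h, Ric⟩_G` (Topping 2006, Prop. 2.3.6);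
* `hasDerivWithinAt_scalAt_eq` — **the first variation of the scalar curvature**;
* `hasDerivWithinAt_normSqAt`, `hasDerivWithinAt_mtrAt_sq`, `hamAt`, `hasDerivWithinAt_hamAt` — the
  first variation of `|K|²_G`, `(tr_G K)²` and of the Hamiltonian constraint density
  `H = S − |K|² + (tr K)²` along a family of data `(G_s, K_s)` (the linearised Hamiltonian
  constraint, Bartnik–Isenberg 2004, §2; Fischer–Marsden).

## References

* A. L. Besse, *Einstein manifolds*, Springer 1987, Thm. 1.174 (a), (e) and 1.181 (p. 63–64).
  [Besse1987]
* P. Topping, *Lectures on the Ricci flow*, LMS Lecture Note Series 325, CUP 2006, Prop. 2.3.1,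
  2.3.6, 2.3.9 and (2.3.14)–(2.3.17). [Topping2006]
-/

noncomputable section

set_option maxSynthPendingDepth 3

open Set Filter ContinuousLinearMap Module
open scoped Topology ContDiff

namespace Literature.Geometry.Lorentzian

namespace MetricCoord

variable {E : Type*} [NormedAddCommGroup E] [NormedSpace ℝ E]

/-! ### The trace vector field of the variation of the Christoffel map -/

section Defs

variable {ι : Type*} [Fintype ι] [FiniteDimensional ℝ E] (b : Basis ι ℝ E)
  (G : ℝ → E → E →L[ℝ] E →L[ℝ] ℝ) (S : Set ℝ) (t : ℝ)

/-- The **metric trace of the variation of the Christoffel map**, the vector field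
`W(y) = Σ_{kl} g^{kl}(y) Π_y(b_k, b_l)` (`Π = ∂_t Γ`, `varChrAt`), written in the basis `b`
(Topping 2006, proof of Prop. 2.3.9, the vector field `g^{ij} Πᵏ_{ij}`; by `apply_varChrTrace`
it is `(div_G h)^♯ − ½ ∇(tr_G h)`, independent of `b`). [cite: Topping2006, Prop. 2.3.9] -/
def varChrTrace (y : E) : E :=
  ∑ k, ∑ l, ginv (G t) b y k l • varChrAt G S t y (b k) (b l)

/-- Unfolding lemma for `varChrTrace`. [cite: Topping2006, Prop. 2.3.9] -/
theorem varChrTrace_apply (y : E) :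
    varChrTrace b G S t y = ∑ k, ∑ l, ginv (G t) b y k l • varChrAt G S t y (b k) (b l) := rfl

end Defs

namespace IsMetricFamilyOn

variable {ι : Type*} [Fintype ι] [FiniteDimensional ℝ E] [CompleteSpace E]
  {G : ℝ → E → E →L[ℝ] E →L[ℝ] ℝ} {S : Set ℝ} {V : Set E} {x : E} {t : ℝ} (b : Basis ι ℝ E)
  (hG : IsMetricFamilyOn G S V)
include hG

omit [Fintype ι] [FiniteDimensional ℝ E] [CompleteSpace E] in
/-- The covariant derivative `∇h` of the (symmetric) variation `h = ∂_t G` is symmetric in its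
last two slots on `V`. [cite: Besse1987, Thm. 1.174] -/
theorem cov₂At_tDeriv_symm (hx : x ∈ V) (ht : t ∈ S) (W Y Z : E) :
    cov₂At (G t) (tDeriv G S t) x W Y Z = cov₂At (G t) (tDeriv G S t) x W Z Y := by
  have hs : ∀ᶠ y in 𝓝 x, ∀ v w, tDeriv G S t y v w = tDeriv G S t y w v := by
    filter_upwards [(hG.isOpen ht).mem_nhds hx] with y hy
    exact hG.tDeriv_symm hy ht
  exact cov₂At_symm (hG.differentiableAt_tDeriv hx ht) hs W Y Z

/-- **`Σ_{kl} g^{kl} (∇_Z h)(b_k, b_l) = ∂_Z (tr_G h)`**: the metric trace commutes with the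
covariant derivative (`∇g = 0`). [cite: Besse1987, 1.181] -/
theorem sum_ginv_cov₂At_tDeriv_eq_fderiv_mtrAt (hx : x ∈ V) (ht : t ∈ S) (Z : E) :
    ∑ k, ∑ l, ginv (G t) b x k l * cov₂At (G t) (tDeriv G S t) x Z (b k) (b l) =
      fderiv ℝ (fun y ↦ mtrAt (G t) y (tDeriv G S t y)) x Z := by
  rw [(hG.isMetricOn t ht).fderiv_mtrAt hx (hG.differentiableAt_tDeriv hx ht) Z, mtrAt_eq_sum b]

/-- **The trace vector field paired with the metric** (Besse 1987, Thm. 1.174 (a) traced over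
its two arguments; Topping 2006, (2.3.15)): for every `Z`,
`G(W, Z) = Σ_{kl} g^{kl} (∇_{b_k} h)(b_l, Z) − ½ ∂_Z (tr_G h)`, i.e. `W = (div_G h)^♯ − ½ ∇ tr_G h`.
[cite: Besse1987, Thm. 1.174 (a)] -/
theorem apply_varChrTrace (hx : x ∈ V) (ht : t ∈ S) (Z : E) :
    G t x (varChrTrace b G S t x) Z =
      ∑ k, ∑ l, ginv (G t) b x k l * cov₂At (G t) (tDeriv G S t) x (b k) (b l) Z
        - 2⁻¹ * fderiv ℝ (fun y ↦ mtrAt (G t) y (tDeriv G S t y)) x Z := by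
  have hGt := hG.isMetricOn t ht
  have hi := hGt.isInvertible x hx
  rw [varChrTrace_apply]
  simp only [map_sum, map_smul, FunLike.coe_sum, Finset.sum_apply,
    FunLike.coe_smul, Pi.smul_apply, smul_eq_mul, hG.apply_varChrAt hx ht]
  -- the second summand equals the first after `k ↔ l`
  have h2 : ∑ k, ∑ l, ginv (G t) b x k l * cov₂At (G t) (tDeriv G S t) x (b l) (b k) Z =
      ∑ k, ∑ l, ginv (G t) b x k l * cov₂At (G t) (tDeriv G S t) x (b k) (b l) Z := by
    rw [Finset.sum_comm]
    refine Finset.sum_congr rfl fun k _ ↦ Finset.sum_congr rfl fun l _ ↦ ?_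
    rw [ginv_comm b hi (hGt.symm x hx) l k]
  have h3 := hG.sum_ginv_cov₂At_tDeriv_eq_fderiv_mtrAt b hx ht Z
  have hsplit : ∑ k, ∑ l, ginv (G t) b x k l * (2⁻¹ *
      (cov₂At (G t) (tDeriv G S t) x (b k) (b l) Z + cov₂At (G t) (tDeriv G S t) x (b l) (b k) Z
        - cov₂At (G t) (tDeriv G S t) x Z (b k) (b l))) =
      2⁻¹ * ((∑ k, ∑ l, ginv (G t) b x k l * cov₂At (G t) (tDeriv G S t) x (b k) (b l) Z)
        + (∑ k, ∑ l, ginv (G t) b x k l * cov₂At (G t) (tDeriv G S t) x (b l) (b k) Z)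
        - ∑ k, ∑ l, ginv (G t) b x k l * cov₂At (G t) (tDeriv G S t) x Z (b k) (b l)) := by
    simp only [Finset.mul_sum, ← Finset.sum_sub_distrib, ← Finset.sum_add_distrib]
    refine Finset.sum_congr rfl fun k _ ↦ Finset.sum_congr rfl fun l _ ↦ ?_
    ring
  rw [hsplit, h2, h3]
  ring

/-- **`tr_X Π(X, Z) = ½ ∂_Z(tr_G h)`** (Topping 2006, (2.3.16); Besse 1987, 1.174 (a) traced over
its first argument): `Σᵢ bⁱ(Π(bᵢ, Z)) = ½ ∂_Z (tr_G h)` on `V`. [cite: Topping2006, Prop. 2.3.9] -/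
theorem sum_coord_varChrAt_eq_half (ht : t ∈ S) {y : E} (hy : y ∈ V) (Z : E) :
    ∑ i, b.coord i (varChrAt G S t y (b i) Z) =
      2⁻¹ * fderiv ℝ (fun z ↦ mtrAt (G t) z (tDeriv G S t z)) y Z := by
  have hGt := hG.isMetricOn t ht
  have hi := hGt.isInvertible y hy
  have hsym := hG.cov₂At_tDeriv_symm (x := y) hy ht
  -- expand `bⁱ(Π(bᵢ,Z)) = Σⱼ g^{ij} G(Π(bᵢ,Z), bⱼ)`
  have hexp : ∑ i, b.coord i (varChrAt G S t y (b i) Z) =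
      2⁻¹ * ((∑ i, ∑ j, ginv (G t) b y i j * cov₂At (G t) (tDeriv G S t) y (b i) Z (b j))
      + (∑ i, ∑ j, ginv (G t) b y i j * cov₂At (G t) (tDeriv G S t) y Z (b i) (b j))
      - ∑ i, ∑ j, ginv (G t) b y i j * cov₂At (G t) (tDeriv G S t) y (b j) (b i) Z) := by
    simp only [coord_eq_sum_ginv b hi, hG.apply_varChrAt hy ht, Finset.mul_sum,
      ← Finset.sum_sub_distrib, ← Finset.sum_add_distrib]
    refine Finset.sum_congr rfl fun i _ ↦ Finset.sum_congr rfl fun j _ ↦ ?_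
    ring
  have h13 : ∑ i, ∑ j, ginv (G t) b y i j * cov₂At (G t) (tDeriv G S t) y (b j) (b i) Z =
      ∑ i, ∑ j, ginv (G t) b y i j * cov₂At (G t) (tDeriv G S t) y (b i) Z (b j) := by
    rw [Finset.sum_comm]
    refine Finset.sum_congr rfl fun i _ ↦ Finset.sum_congr rfl fun j _ ↦ ?_
    rw [ginv_comm b hi (hGt.symm y hy) j i, hsym (b i) Z (b j)]
  have h2 := hG.sum_ginv_cov₂At_tDeriv_eq_fderiv_mtrAt b hy ht Z
  rw [hexp, h13, h2]
  ring

/-- The trace vector field `W` is differentiable on `V`. [cite: Topping2006, Prop. 2.3.9] -/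
theorem differentiableAt_varChrTrace (hx : x ∈ V) (ht : t ∈ S) :
    DifferentiableAt ℝ (varChrTrace b G S t) x := by
  have hGt := hG.isMetricOn t ht
  have hPd := hG.differentiableAt_varChrAt hx ht
  have hg : ∀ k l, DifferentiableAt ℝ (fun y ↦ ginv (G t) b y k l) x := fun k l ↦
    ((hGt.contDiffOn_ginv b k l).contDiffAt (hGt.mem_nhds hx)).differentiableAt (by simp)
  have hP : ∀ k l, DifferentiableAt ℝ (fun y ↦ varChrAt G S t y (b k) (b l)) x := fun k l ↦
    differentiableAt_clm_apply_const (differentiableAt_clm_apply_const hPd (b k)) (b l)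
  have heq : varChrTrace b G S t = fun y ↦ ∑ k, ∑ l, ginv (G t) b y k l • varChrAt G S t y (b k) (b l) :=
    rfl
  rw [heq]
  exact DifferentiableAt.fun_sum fun k _ ↦ DifferentiableAt.fun_sum fun l _ ↦ (hg k l).smul (hP k l)

/-- **The `div`-type contraction of `DΠ`**: for every functional `φ` and direction `X`,
`Σ_{kl} g^{kl} [φ(D_XΠ(b_k,b_l)) − φ(Π(Γ(X,b_k),b_l)) − φ(Π(b_k,Γ(X,b_l)))] = ∂_X (φ ∘ W)`
(the metric trace commutes with `∇`: `tr_G ∇_X(φ∘Π) = ∂_X tr_G(φ∘Π) = ∂_X φ(W)`).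
[cite: Topping2006, Prop. 2.3.9] -/
theorem sum_ginv_fderiv_varChrAt_eq_fderiv (hx : x ∈ V) (ht : t ∈ S) (φ : E →L[ℝ] ℝ) (X : E) :
    ∑ k, ∑ l, ginv (G t) b x k l * (φ (fderiv ℝ (varChrAt G S t) x X (b k) (b l))
      - φ (varChrAt G S t x (chrAt (G t) x X (b k)) (b l))
      - φ (varChrAt G S t x (b k) (chrAt (G t) x X (b l)))) =
      fderiv ℝ (fun y ↦ φ (varChrTrace b G S t y)) x X := by
  have hGt := hG.isMetricOn t ht
  have hPd := hG.differentiableAt_varChrAt hx ht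
  -- the scalar field of bilinear forms `β_φ = φ ∘ Π`
  set β : E → E →L[ℝ] E →L[ℝ] ℝ := fun y ↦
    (ContinuousLinearMap.compL ℝ E E ℝ φ).comp (varChrAt G S t y) with hβ
  have hβapp : ∀ y Y Z, β y Y Z = φ (varChrAt G S t y Y Z) := fun y Y Z ↦ rfl
  have hβd : HasFDerivAt β ((ContinuousLinearMap.compL ℝ E (E →L[ℝ] E) (E →L[ℝ] ℝ)
      (ContinuousLinearMap.compL ℝ E E ℝ φ)).comp (fderiv ℝ (varChrAt G S t) x)) x :=
    (ContinuousLinearMap.compL ℝ E (E →L[ℝ] E) (E →L[ℝ] ℝ)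
      (ContinuousLinearMap.compL ℝ E E ℝ φ)).hasFDerivAt.comp x hPd.hasFDerivAt
  have hDβ : ∀ Y Z, fderiv ℝ β x X Y Z = φ (fderiv ℝ (varChrAt G S t) x X Y Z) := by
    intro Y Z; rw [hβd.fderiv]; rfl
  -- its metric trace is `φ (W)` everywhere
  have htr : (fun y ↦ mtrAt (G t) y (β y)) = fun y ↦ φ (varChrTrace b G S t y) := by
    funext y
    rw [mtrAt_eq_sum b, varChrTrace_apply, map_sum]
    refine Finset.sum_congr rfl fun k _ ↦ ?_
    rw [map_sum]
    refine Finset.sum_congr rfl fun l _ ↦ ?_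
    rw [map_smul, smul_eq_mul, hβapp]
  have hD := hGt.fderiv_mtrAt hx hβd.differentiableAt X
  rw [htr, mtrAt_eq_sum b] at hD
  simp only [cov₂At_apply, hDβ, hβapp] at hD
  exact hD.symm

/-- **The first (`div`) trace of `∂_t Ric` is the divergence of the trace vector field**:
`Σ_{kl} g^{kl} Σᵢ bⁱ((∇_{bᵢ}Π)(b_k) b_l) = div W` (Topping 2006, proof of Prop. 2.3.9, the term
`δ(g^{ij}Π_{ij})`). [cite: Topping2006, Prop. 2.3.9] -/
theorem termA_eq_divAt (hx : x ∈ V) (ht : t ∈ S) :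
    ∑ k, ∑ l, ginv (G t) b x k l * ∑ i, b.coord i
      (fderiv ℝ (varChrAt G S t) x (b i) (b k) (b l)
        + chrAt (G t) x (b i) (varChrAt G S t x (b k) (b l))
        - varChrAt G S t x (chrAt (G t) x (b i) (b k)) (b l)
        - varChrAt G S t x (b k) (chrAt (G t) x (b i) (b l))) = divAt (G t) (varChrTrace b G S t) x := by
  have hGt := hG.isMetricOn t ht
  have hW := hG.differentiableAt_varChrTrace b hx ht
  have hstar := fun i ↦ hG.sum_ginv_fderiv_varChrAt_eq_fderiv b hx ht (coordCLM b i) (b i)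
  simp only [coordCLM_apply] at hstar
  -- the `Γ` term: `Σ_{kl} g^{kl} bⁱ(Γᵢ Π(b_k,b_l)) = bⁱ(Γᵢ W)`
  have hΓ : ∀ i, ∑ k, ∑ l, ginv (G t) b x k l *
      b.coord i (chrAt (G t) x (b i) (varChrAt G S t x (b k) (b l))) =
      b.coord i (chrAt (G t) x (b i) (varChrTrace b G S t x)) := by
    intro i
    rw [varChrTrace_apply]
    simp only [map_sum, map_smul, smul_eq_mul]
  -- the derivative term: `∂_{bᵢ} bⁱ(W) = bⁱ(DW bᵢ)`
  have hDW : ∀ i, fderiv ℝ (fun y ↦ b.coord i (varChrTrace b G S t y)) x (b i) =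
      b.coord i (fderiv ℝ (varChrTrace b G S t) x (b i)) := by
    intro i
    have h := ((coordCLM b i).hasFDerivAt.comp x hW.hasFDerivAt).fderiv
    have heq : (fun y ↦ b.coord i (varChrTrace b G S t y)) = (coordCLM b i) ∘ varChrTrace b G S t :=
      rfl
    rw [heq, h, ContinuousLinearMap.comp_apply, coordCLM_apply]
  -- reorganise the sums
  calc ∑ k, ∑ l, ginv (G t) b x k l * ∑ i, b.coord i
        (fderiv ℝ (varChrAt G S t) x (b i) (b k) (b l)
          + chrAt (G t) x (b i) (varChrAt G S t x (b k) (b l))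
          - varChrAt G S t x (chrAt (G t) x (b i) (b k)) (b l)
          - varChrAt G S t x (b k) (chrAt (G t) x (b i) (b l)))
      = ∑ i, (∑ k, ∑ l, ginv (G t) b x k l * (b.coord i (fderiv ℝ (varChrAt G S t) x (b i) (b k) (b l))
          - b.coord i (varChrAt G S t x (chrAt (G t) x (b i) (b k)) (b l))
          - b.coord i (varChrAt G S t x (b k) (chrAt (G t) x (b i) (b l))))
        + ∑ k, ∑ l, ginv (G t) b x k l *
            b.coord i (chrAt (G t) x (b i) (varChrAt G S t x (b k) (b l)))) := by
        simp only [map_add, map_sub, Finset.mul_sum, mul_add, mul_sub]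
        rw [sum_comm₃]
        refine Finset.sum_congr rfl fun i _ ↦ ?_
        rw [← Finset.sum_add_distrib]
        refine Finset.sum_congr rfl fun k _ ↦ ?_
        rw [← Finset.sum_add_distrib]
        refine Finset.sum_congr rfl fun l _ ↦ ?_
        ring
    _ = ∑ i, b.coord i (covDAt (G t) (varChrTrace b G S t) x (b i)) := by
        refine Finset.sum_congr rfl fun i _ ↦ ?_
        rw [hstar i, hΓ i, hDW i, covDAt_apply, map_add, hGt.chrAt_comm hx (varChrTrace b G S t x) (b i)]
    _ = divAt (G t) (varChrTrace b G S t) x := by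
        rw [divAt_eq, traceCLM_apply, trace_eq_sum_coord b]
        rfl

/-- The metric trace `tr_G h` of the variation is smooth on `V`. [cite: Besse1987, 1.181] -/
theorem contDiffAt_mtrAt_tDeriv (hx : x ∈ V) (ht : t ∈ S) :
    ContDiffAt ℝ ∞ (fun y ↦ mtrAt (G t) y (tDeriv G S t y)) x := by
  have hGt := hG.isMetricOn t ht
  have hh : ContDiffAt ℝ ∞ (tDeriv G S t) x :=
    (hG.contDiffOn_tDeriv ht x hx).contDiffAt ((hG.isOpen ht).mem_nhds hx)
  have hc : ContDiffAt ℝ ∞ (fun y ↦ (sharpAt (G t) y).comp (tDeriv G S t y)) x :=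
    (hGt.contDiffAt_sharpAt hx).clm_comp hh
  have heq : (fun y ↦ mtrAt (G t) y (tDeriv G S t y)) =
      fun y ↦ traceCLM E ((sharpAt (G t) y).comp (tDeriv G S t y)) := by
    funext y; rw [traceCLM_apply]; rfl
  rw [heq]
  exact (traceCLM E).contDiff.contDiffAt.comp x hc

/-- **The second trace of `∂_t Ric` is `½ Δ(tr_G h)`**:
`Σ_{kl} g^{kl} Σᵢ bⁱ((∇_{b_k}Π)(bᵢ) b_l) = ½ Δ_G(tr_G h)` (`tr Π(·,Z) = ½ d(tr_G h)(Z)`, so the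
trace is `½ tr_G ∇d(tr_G h) = ½ tr_G Hess(tr_G h)`; Topping 2006, (2.3.16)–(2.3.17)).
[cite: Topping2006, Prop. 2.3.9] -/
theorem termB_eq_half_lapAt (hx : x ∈ V) (ht : t ∈ S) :
    ∑ k, ∑ l, ginv (G t) b x k l * ∑ i, b.coord i
      (fderiv ℝ (varChrAt G S t) x (b k) (b i) (b l)
        + chrAt (G t) x (b k) (varChrAt G S t x (b i) (b l))
        - varChrAt G S t x (chrAt (G t) x (b k) (b i)) (b l)
        - varChrAt G S t x (b i) (chrAt (G t) x (b k) (b l))) =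
      2⁻¹ * lapAt (G t) (fun y ↦ mtrAt (G t) y (tDeriv G S t y)) x := by
  have hGt := hG.isMetricOn t ht
  have hPd := hG.differentiableAt_varChrAt hx ht
  set τ : E → ℝ := fun y ↦ mtrAt (G t) y (tDeriv G S t y) with hτ
  have hSc : ContDiffAt ℝ ∞ τ x := hG.contDiffAt_mtrAt_tDeriv hx ht
  have hdτ : DifferentiableAt ℝ (fderiv ℝ τ) x :=
    (hSc.fderiv_right (m := ∞) (by simp)).differentiableAt (by simp)
  -- `ω(y)(Z) = Σᵢ bⁱ(Π_y(bᵢ, Z)) = ½ dτ_y(Z)` near `x`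
  have hω : ∀ Z, (fun y ↦ ∑ i, b.coord i (varChrAt G S t y (b i) Z)) =ᶠ[𝓝 x]
      fun y ↦ 2⁻¹ * fderiv ℝ τ y Z := fun Z ↦ by
    filter_upwards [(hG.isOpen ht).mem_nhds hx] with y hy
    exact hG.sum_coord_varChrAt_eq_half b ht hy Z
  -- (1) the `DΠ` term
  have h1 : ∀ k l, ∑ i, b.coord i (fderiv ℝ (varChrAt G S t) x (b k) (b i) (b l)) =
      2⁻¹ * fderiv ℝ (fderiv ℝ τ) x (b k) (b l) := by
    intro k l
    have hdiff : ∀ i, DifferentiableAt ℝ (fun y ↦ varChrAt G S t y (b i) (b l)) x := fun i ↦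
      differentiableAt_clm_apply_const (differentiableAt_clm_apply_const hPd (b i)) (b l)
    have hsum : fderiv ℝ (fun y ↦ ∑ i, b.coord i (varChrAt G S t y (b i) (b l))) x (b k) =
        ∑ i, b.coord i (fderiv ℝ (varChrAt G S t) x (b k) (b i) (b l)) := by
      have hs : HasFDerivAt (fun y ↦ ∑ i, coordCLM b i (varChrAt G S t y (b i) (b l)))
          (∑ i, (coordCLM b i).comp (fderiv ℝ (fun y ↦ varChrAt G S t y (b i) (b l)) x)) x :=
        HasFDerivAt.fun_sum fun i _ ↦ (coordCLM b i).hasFDerivAt.comp x (hdiff i).hasFDerivAt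
      simp only [coordCLM_apply] at hs
      rw [hs.fderiv, FunLike.coe_sum, Finset.sum_apply]
      refine Finset.sum_congr rfl fun i _ ↦ ?_
      rw [ContinuousLinearMap.comp_apply, coordCLM_apply,
        fderiv_clm_apply_const (differentiableAt_clm_apply_const hPd (b i)) (b l) (b k),
        fderiv_clm_apply_const hPd (b i) (b k)]
    have hdτl : DifferentiableAt ℝ (fun y ↦ fderiv ℝ τ y (b l)) x :=
      differentiableAt_clm_apply_const hdτ (b l)
    rw [← hsum, (hω (b l)).fderiv_eq, fderiv_const_mul hdτl, _root_.smul_apply,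
      smul_eq_mul, fderiv_clm_apply_const hdτ (b l) (b k)]
  -- (2) the `Γ ∘ Π` and `Π ∘ Γ` terms cancel (trace of a commutator)
  have h2 : ∀ k l, ∑ i, b.coord i (chrAt (G t) x (b k) (varChrAt G S t x (b i) (b l))) =
      ∑ i, b.coord i (varChrAt G S t x (chrAt (G t) x (b k) (b i)) (b l)) := fun k l ↦
    sum_coord_comp_comm b (chrAt (G t) x (b k)) ((varChrAt G S t x).flip (b l))
  -- (3) the last term
  have h3 : ∀ k l, ∑ i, b.coord i (varChrAt G S t x (b i) (chrAt (G t) x (b k) (b l))) =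
      2⁻¹ * fderiv ℝ τ x (chrAt (G t) x (b k) (b l)) := fun k l ↦
    hG.sum_coord_varChrAt_eq_half b ht hx _
  rw [lapAt_eq_sum (G t) b, Finset.mul_sum]
  refine Finset.sum_congr rfl fun k _ ↦ ?_
  rw [Finset.mul_sum]
  refine Finset.sum_congr rfl fun l _ ↦ ?_
  simp only [map_add, map_sub, Finset.sum_add_distrib, Finset.sum_sub_distrib, h1, h2, h3]
  ring

omit [CompleteSpace E] hG in
/-- **The `Σ ∂_t g^{kl} Ric_{kl}` term is `−⟨h, Ric⟩_G`** (Topping 2006, Prop. 2.3.6 with `α = Ric`: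
`∂_t g^{kl} = −h^{kl}`). [cite: Topping2006, Prop. 2.3.6] -/
theorem sum_dginv_ricAt_eq_neg_pairAt :
    ∑ k, ∑ l, b.coord k (-(sharpAt (G t) x (tDeriv G S t x (sharpAt (G t) x (coordCLM b l)))))
      * ricAt (G t) x (b k) (b l) = -pairAt (G t) x (tDeriv G S t x) (ricAt (G t) x) := by
  rw [pairAt_apply, traceCLM_apply, trace_eq_sum_coord b, ← Finset.sum_neg_distrib]
  refine Finset.sum_congr rfl fun k _ ↦ ?_
  have hRk : ricAt (G t) x (b k) = ∑ l, ricAt (G t) x (b k) (b l) • coordCLM b l :=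
    eq_sum_smul_coordCLM b _
  simp only [map_neg, neg_mul, Finset.sum_neg_distrib, ContinuousLinearMap.coe_coe,
    ContinuousLinearMap.comp_apply]
  conv_rhs => rw [hRk]
  simp only [map_sum, map_smul, smul_eq_mul]
  congr 1
  refine Finset.sum_congr rfl fun l _ ↦ ?_
  ring

/-- **Besse 1987, Thm. 1.174 (e) / Topping 2006, Prop. 2.3.9, in coordinates (the first variation
of the scalar curvature in a general direction).** Let `G` be a smooth one-parameter family of
metric components on `V × S` (`IsMetricFamilyOn`, any signature) with variation
`h = ∂G/∂t` (`tDeriv`). Then at every `t ∈ S`, `x ∈ V` the scalar curvature `s ↦ S(G s)(x)` is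
differentiable within `S` with derivative

  `∂_t S = −⟨h, Ric⟩_G + div W − ½ Δ_G(tr_G h)`,

where `W` is the trace vector field of the variation of the Christoffel map (`varChrTrace`, in
any basis `b`), characterised by `G(W, Z) = Σ_{kl} g^{kl}(∇_{b_k} h)(b_l, Z) − ½ ∂_Z(tr_G h)`
(`apply_varChrTrace`: `W = (div_G h)^♯ − ½ ∇ tr_G h`, so that `div W − ½ Δ tr_G h` is
`div_G div_G h − Δ_G tr_G h`; Besse's `Δ_g(tr_g h) + δ_g δ_g h − g(r_g, h)` with `Δ_g = δ d = −Δ_G`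
and `δ_g = −div_G`). [cite: Besse1987, Thm. 1.174 (e)] -/
theorem hasDerivWithinAt_scalAt_eq (hx : x ∈ V) (ht : t ∈ S) :
    HasDerivWithinAt (fun s ↦ scalAt (G s) x)
      (-pairAt (G t) x (tDeriv G S t x) (ricAt (G t) x)
        + divAt (G t) (varChrTrace b G S t) x
        - 2⁻¹ * lapAt (G t) (fun y ↦ mtrAt (G t) y (tDeriv G S t y)) x) S t := by
  have hGt := hG.isMetricOn t ht
  have hd := hG.hasDerivWithinAt_scalAt b hx ht
  refine hd.congr_deriv ?_
  rw [Finset.sum_congr rfl fun k _ ↦ Finset.sum_add_distrib, Finset.sum_add_distrib,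
    sum_dginv_ricAt_eq_neg_pairAt b]
  -- the `tr_G ∂_t Ric` term: expand `varRiemAt` into the two traces
  have hA := hG.termA_eq_divAt b hx ht
  have hB := hG.termB_eq_half_lapAt b hx ht
  have hc := hGt.chrAt_comm hx
  have hsplit : ∑ k, ∑ l, ginv (G t) b x k l * ∑ i, b.coord i (varRiemAt G S t x (b i) (b k) (b l)) =
      (∑ k, ∑ l, ginv (G t) b x k l * ∑ i, b.coord i
        (fderiv ℝ (varChrAt G S t) x (b i) (b k) (b l)
          + chrAt (G t) x (b i) (varChrAt G S t x (b k) (b l))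
          - varChrAt G S t x (chrAt (G t) x (b i) (b k)) (b l)
          - varChrAt G S t x (b k) (chrAt (G t) x (b i) (b l))))
      - ∑ k, ∑ l, ginv (G t) b x k l * ∑ i, b.coord i
        (fderiv ℝ (varChrAt G S t) x (b k) (b i) (b l)
          + chrAt (G t) x (b k) (varChrAt G S t x (b i) (b l))
          - varChrAt G S t x (chrAt (G t) x (b k) (b i)) (b l)
          - varChrAt G S t x (b i) (chrAt (G t) x (b k) (b l))) := by
    rw [← Finset.sum_sub_distrib]
    refine Finset.sum_congr rfl fun k _ ↦ ?_
    rw [← Finset.sum_sub_distrib]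
    refine Finset.sum_congr rfl fun l _ ↦ ?_
    rw [← mul_sub, ← Finset.sum_sub_distrib]
    congr 1
    refine Finset.sum_congr rfl fun i _ ↦ ?_
    rw [← map_sub]
    congr 1
    simp only [varRiemAt_apply, hc (b k) (b i)]
    abel
  rw [hsplit, hA, hB]
  ring


/-! ### The first variation of `|K|²_G`, `(tr_G K)²` and of the Hamiltonian constraint density -/

omit [Fintype ι] in
/-- **`∂_t |K_t|²_{G_t} = 2⟨K̇, K⟩_G − 2 tr(♯h ♯K ♯K)`** for a family of symmetric forms `K_s` at `x`
differentiable within `S` at `t` with symmetric derivative `K̇` (`∂_t ♯ = −♯ h ♯`, Topping 2006,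
§2.3.2, and the Leibniz rule; the term `−2 h_{ij} K^i{}_l K^{lj}` of the linearised Hamiltonian
constraint). [cite: Topping2006, §2.3.2] -/
theorem hasDerivWithinAt_normSqAt (hx : x ∈ V) (ht : t ∈ S)
    {K : ℝ → E →L[ℝ] E →L[ℝ] ℝ} {κ : E →L[ℝ] E →L[ℝ] ℝ} (hK : HasDerivWithinAt K κ S t)
    (hKs : ∀ v w, K t v w = K t w v) (hκs : ∀ v w, κ v w = κ w v) :
    HasDerivWithinAt (fun s ↦ normSqAt (G s) x (K s))
      (2 * pairAt (G t) x κ (K t)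
        - 2 * traceCLM E ((((sharpAt (G t) x).comp (tDeriv G S t x)).comp
            ((sharpAt (G t) x).comp (K t))).comp ((sharpAt (G t) x).comp (K t)))) S t := by
  have hs := hG.hasDerivWithinAt_sharpAt hx ht
  -- `A_s = ♯_s ∘ K_s`, `B_s = ♯_s ∘ K_sᵀ`
  have hA := hs.clm_comp hK
  have hKf : HasDerivWithinAt (fun s ↦ (K s).flip) κ.flip S t :=
    (flipCLM (E := E)).hasFDerivAt.comp_hasDerivWithinAt t hK
  have hB := hs.clm_comp hKf
  have hAB := hA.clm_comp hB
  have htr := (traceCLM E).hasFDerivAt.comp_hasDerivWithinAt t hAB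
  have hfun : (fun s ↦ normSqAt (G s) x (K s)) =
      (traceCLM E) ∘ fun s ↦ ((sharpAt (G s) x).comp (K s)).comp ((sharpAt (G s) x).comp (K s).flip) :=
    funext fun s ↦ normSqAt_eq_traceCLM _ _ _
  rw [hfun]
  refine htr.congr_deriv ?_
  -- algebra: `K` and `κ` are symmetric, traces are cyclic
  have hKfl : (K t).flip = K t := by ext v w; exact hKs w v
  have hκfl : κ.flip = κ := by ext v w; exact hκs w v
  set Sh := sharpAt (G t) x
  set h := tDeriv G S t x
  set Kt := K t
  rw [hKfl, hκfl]
  simp only [pairAt_apply]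
  -- expand the derivative `(A' ∘ B) + (A ∘ B')`
  have e1 : traceCLM E (((-Sh.comp (h.comp Sh)).comp Kt + Sh.comp κ).comp (Sh.comp Kt)
      + (Sh.comp Kt).comp ((-Sh.comp (h.comp Sh)).comp Kt + Sh.comp κ)) =
      2 * traceCLM E ((Sh.comp κ).comp (Sh.comp Kt))
        - 2 * traceCLM E (((Sh.comp h).comp (Sh.comp Kt)).comp (Sh.comp Kt)) := by
    have c1 : traceCLM E ((Sh.comp Kt).comp (Sh.comp κ)) = traceCLM E ((Sh.comp κ).comp (Sh.comp Kt)) :=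
      traceCLM_comp_comm _ _
    have c2 : traceCLM E ((Sh.comp Kt).comp ((Sh.comp (h.comp Sh)).comp Kt)) =
        traceCLM E (((Sh.comp h).comp (Sh.comp Kt)).comp (Sh.comp Kt)) := by
      rw [traceCLM_comp_comm]
      rfl
    have c3 : traceCLM E (((Sh.comp (h.comp Sh)).comp Kt).comp (Sh.comp Kt)) =
        traceCLM E (((Sh.comp h).comp (Sh.comp Kt)).comp (Sh.comp Kt)) := rfl
    simp only [ContinuousLinearMap.add_comp, ContinuousLinearMap.comp_add, ContinuousLinearMap.neg_comp,
      ContinuousLinearMap.comp_neg, map_add, map_neg, c1, c2, c3]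
    ring
  exact e1

omit [Fintype ι] in
/-- **`∂_t (tr_{G_t} K_t)² = 2 tr_G K (tr_G K̇ − ⟨h, K⟩_G)`** (Topping 2006, Prop. 2.3.6:
`∂_t tr α = −⟨h, α⟩ + tr ∂_t α`). [cite: Topping2006, Prop. 2.3.6] -/
theorem hasDerivWithinAt_mtrAt_sq (hx : x ∈ V) (ht : t ∈ S)
    {K : ℝ → E →L[ℝ] E →L[ℝ] ℝ} {κ : E →L[ℝ] E →L[ℝ] ℝ} (hK : HasDerivWithinAt K κ S t) :
    HasDerivWithinAt (fun s ↦ mtrAt (G s) x (K s) ^ 2)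
      (2 * mtrAt (G t) x (K t) * (mtrAt (G t) x κ - pairAt (G t) x (tDeriv G S t x) (K t))) S t := by
  have h := (hG.hasDerivWithinAt_mtrAt hx ht hK).pow 2
  refine h.congr_deriv ?_
  rw [pairAt_apply]
  simp only [Nat.cast_ofNat]
  ring

end IsMetricFamilyOn

/-- The **Hamiltonian constraint density in coordinates** of a pair of fields of bilinear forms
`(G, K)` (metric components and second fundamental form) at `x`:
`H = S_G − |K|²_G + (tr_G K)²` (the chart expression of `InitialDataSet.hamiltonianConstraintFn`;
Choquet-Bruhat 2009, Ch. VI, (3.12); Bartnik–Isenberg 2004, (2.1)). [cite: BartnikIsenberg2004, (2.1)] -/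
def hamAt [FiniteDimensional ℝ E] (G K : E → E →L[ℝ] E →L[ℝ] ℝ) (x : E) : ℝ :=
  scalAt G x - normSqAt G x (K x) + mtrAt G x (K x) ^ 2

/-- Unfolding lemma for `hamAt`. [cite: BartnikIsenberg2004, (2.1)] -/
theorem hamAt_eq [FiniteDimensional ℝ E] (G K : E → E →L[ℝ] E →L[ℝ] ℝ) (x : E) :
    hamAt G K x = scalAt G x - normSqAt G x (K x) + mtrAt G x (K x) ^ 2 := rfl

namespace IsMetricFamilyOn

variable {ι : Type*} [Fintype ι] [FiniteDimensional ℝ E] [CompleteSpace E]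
  {G : ℝ → E → E →L[ℝ] E →L[ℝ] ℝ} {S : Set ℝ} {V : Set E} {x : E} {t : ℝ} (b : Basis ι ℝ E)
  (hG : IsMetricFamilyOn G S V)
include hG

/-- **The first variation of the Hamiltonian constraint density** along a smooth family of metric
components `G_s` (`h = ∂_t G`) and a family of symmetric second fundamental forms `K_s` with
symmetric variation `K̇` at `x` (Bartnik–Isenberg 2004, §2, the linearisation of (2.1);
Fischer–Marsden): `∂_t H = [−⟨h, Ric⟩_G + div W − ½ Δ_G tr_G h] − [2⟨K̇, K⟩_G − 2 tr(♯h♯K♯K)]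
+ 2 tr_G K (tr_G K̇ − ⟨h, K⟩_G)`. [cite: Besse1987, Thm. 1.174 (e)] -/
theorem hasDerivWithinAt_hamAt (hx : x ∈ V) (ht : t ∈ S)
    {K : ℝ → E → E →L[ℝ] E →L[ℝ] ℝ} {κ : E →L[ℝ] E →L[ℝ] ℝ}
    (hK : HasDerivWithinAt (fun s ↦ K s x) κ S t)
    (hKs : ∀ v w, K t x v w = K t x w v) (hκs : ∀ v w, κ v w = κ w v) :
    HasDerivWithinAt (fun s ↦ hamAt (G s) (K s) x)
      ((-pairAt (G t) x (tDeriv G S t x) (ricAt (G t) x)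
          + divAt (G t) (varChrTrace b G S t) x
          - 2⁻¹ * lapAt (G t) (fun y ↦ mtrAt (G t) y (tDeriv G S t y)) x)
        - (2 * pairAt (G t) x κ (K t x)
          - 2 * traceCLM E ((((sharpAt (G t) x).comp (tDeriv G S t x)).comp
              ((sharpAt (G t) x).comp (K t x))).comp ((sharpAt (G t) x).comp (K t x))))
        + 2 * mtrAt (G t) x (K t x) * (mtrAt (G t) x κ - pairAt (G t) x (tDeriv G S t x) (K t x)))
      S t :=
  ((hG.hasDerivWithinAt_scalAt_eq b hx ht).sub
    (hG.hasDerivWithinAt_normSqAt (K := fun s ↦ K s x) hx ht hK hKs hκs)).add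
    (hG.hasDerivWithinAt_mtrAt_sq (K := fun s ↦ K s x) hx ht hK)

end IsMetricFamilyOn

end MetricCoord

end Literature.Geometry.Lorentzian

end
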